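import Literature.Geometry.Riemannian.WassersteinW1Duality
import Literature.Geometry.Riemannian.WassersteinW1Complete
import HarnessLib

/-!
# `W₁`-convergence from weak convergence and bounded second moments (Bamler 2023, §2.2, Lemma
# (arXiv v1 Lemma 12) and §7.3; Villani 2003, Thm. 7.12)

R. Bamler, *Compactness theory of the space of super Ricci flows*, Invent. Math. 233 (2023), §2.2,
Lemma (arXiv v1 Lemma 12): *"Suppose that `(X, d)` is complete and separable and consider a
sequence `μ_i ∈ 𝒫(X)` that weakly converges to some `μ_∞ ∈ 𝒫(X)` and satisfies
`Var(μ_i) ≤ C < ∞`. Then `μ_i → μ_∞` in `d_{W₁}` and `Var(μ_∞) ≤ liminf_{i → ∞} Var(μ_i)`. Proof.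
See [Villani, Topics in Optimal Transportation]."* (Villani 2003, Thm. 7.12: `W_p` metrizes weak
convergence together with the convergence — or uniform integrability — of `p`-th moments.) It is
used in §7.3, proof of the Claim (arXiv v1 Claim 162): *"Due to Lemmas 2.4 (d) [tight sequences
subconverge weakly], [§2.2, Lemma] it suffices to show that the sequence of probability measures
`(φ^i_{t_l})_* ν^i_{x^i; t_l}` on `Z_{t_l}` is tight"* — weak subconvergence of conjugate heat
kernels with uniformly bounded variances is upgraded to `W₁`-convergence.

We prove it for the tree's `wassersteinW1` (`MetricFlowConcentration.lean`), with the pointed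
second moment `Var(δ_{z₀}, μ) = ∫ d(z₀, ·)² dμ` (Bamler 2023, §2.2) as the variance bound:

* `tendsto_wassersteinW1_of_tendsto_of_variance_le` — **weak convergence `α_n → α_∞` in `𝒫(Z)`
  and `∫ d(z₀, ·)² dα_n ≤ V` imply `d_{W₁}(α_n, α_∞) → 0`** on a complete separable metric space;
* `exists_subseq_tendsto_wassersteinW1_of_isTightMeasureSet` — the form used in §7.3: a tight
  sequence of probability measures with `∫ d(z₀, ·)² dα_n ≤ V` has a subsequence `W₁`-converging
  to a probability measure `α_∞` with `∫ d(z₀, ·)² dα_∞ ≤ V` (Prokhorov: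
  `isCompact_closure_of_isTightMeasureSet`, then the first theorem);
* `lintegral_edist_sq_le_of_tendsto` — `Var(δ_{z₀}, α_∞) ≤ V` for the weak limit (portmanteau).

Proof of the first theorem (after Villani 2003, §7.1, without optimal couplings): by
Kantorovich–Rubinstein duality in working form (`wassersteinW1_le_of_forall_integral_sub_le`) it
suffices to bound `∫ u dα_n − ∫ u dα_∞ ≤ δ` for `n ≥ N(δ)` *uniformly* over bounded `1`-Lipschitz
`u`, normalised to `u(z₀) = 0`. (a) *Tails*: the truncation `u_R := max(min(u, R), −R)` satisfies
`|u − u_R| ≤ d(z₀, ·)²/R`, so `|∫ u dμ − ∫ u_R dμ| ≤ V/R` for `μ = α_n, α_∞`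
(`abs_integral_sub_integral_trunc_le`). (b) *Uniformity*: weak convergence on a separable space is
convergence for the Lévy–Prokhorov metric (`LevyProkhorov.continuous_ofMeasure_probabilityMeasure`
in Mathlib), and `d_{LP}(μ, ν) < η` gives `∫ f dμ ≤ ∫ f dν + (M + 1) η` for every `1`-Lipschitz `f`
with `0 ≤ f ≤ M` (`integral_le_integral_add_of_levyProkhorovEDist_lt`), by the layer-cake formula
`∫ f dμ = ∫₀^M μ(f ≥ t) dt` and `μ(f ≥ t) ≤ ν((f ≥ t)_η) + η ≤ ν(f + η ≥ t) + η`. With `R ~ V/δ` and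
`η ~ δ/R` the errors add up to `δ`.

Everything is proved; no definitions, no named facts.

## References

* R. H. Bamler, *Compactness theory of the space of super Ricci flows*, Invent. Math. 233 (2023),
  1121–1277 (arXiv:2008.09298), §2.1, Lemma 2.4 (d) (tight sequences subconverge weakly); §2.2,
  Lemma (weak convergence and bounded variance imply `W₁`-convergence; arXiv v1 Lemma 12); §7.3,
  proof of the Claim (arXiv v1 Claim 162). [Bamler2023]
* C. Villani, *Topics in Optimal Transportation*, GSM 58 (AMS 2003), §7.1 and Thm. 7.12 (`W_p`
  metrizes weak convergence plus convergence of moments). [Villani2003]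
-/

noncomputable section

open Set MeasureTheory Filter TopologicalSpace Function
open scoped Topology ENNReal NNReal

namespace Literature.Geometry.Riemannian

universe u

/-! ### Integrals of Lipschitz functions under a small Lévy–Prokhorov distance -/

section LevyProkhorov

variable {Z : Type*} [PseudoMetricSpace Z] [MeasurableSpace Z] [OpensMeasurableSpace Z]

omit [PseudoMetricSpace Z] [OpensMeasurableSpace Z] in
/-- `t ↦ μ(g ≥ t)` is integrable on bounded intervals, for a probability measure `μ`. [folklore] -/
private theorem integrableOn_measureReal_le (μ : Measure Z) [IsProbabilityMeasure μ] {g : Z → ℝ}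
    (a b : ℝ) : IntegrableOn (fun t ↦ μ.real {x | t ≤ g x}) (Ioc a b) := by
  have hanti : Antitone (fun t : ℝ ↦ μ {x | t ≤ g x}) := fun s t hst ↦
    measure_mono fun x (hx : t ≤ g x) ↦ hst.trans hx
  refine Measure.integrableOn_of_bounded (M := 1) measure_Ioc_lt_top.ne
    hanti.measurable.ennreal_toReal.aestronglyMeasurable (Eventually.of_forall fun t ↦ ?_)
  rw [Real.norm_eq_abs, abs_of_nonneg measureReal_nonneg]
  exact measureReal_le_one

/-- **Lipschitz integrals under a small Lévy–Prokhorov distance**: if `d_{LP}(μ, ν) < η` and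
`f` is `1`-Lipschitz with `0 ≤ f ≤ M`, then `∫ f dμ ≤ ∫ f dν + (M + 1) η` — layer cake:
`∫ f dμ = ∫₀^M μ(f ≥ t) dt`, `μ(f ≥ t) ≤ ν((f ≥ t)_η) + η ≤ ν(f + η ≥ t) + η`, and
`∫₀^{M+η} ν(f + η ≥ t) dt = ∫ (f + η) dν`. [folklore] -/
theorem integral_le_integral_add_of_levyProkhorovEDist_lt {μ ν : Measure Z}
    [IsProbabilityMeasure μ] [IsProbabilityMeasure ν] {η M : ℝ} (hη : 0 < η) (hM : 0 ≤ M)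
    (h : levyProkhorovEDist μ ν < ENNReal.ofReal η) {f : Z → ℝ} (hf : LipschitzWith 1 f)
    (hf0 : ∀ x, 0 ≤ f x) (hfM : ∀ x, f x ≤ M) :
    ∫ x, f x ∂μ ≤ ∫ x, f x ∂ν + (M + 1) * η := by
  have hfm : Measurable f := hf.continuous.measurable
  have hfi : ∀ (ρ : Measure Z) [IsFiniteMeasure ρ], Integrable f ρ := fun ρ _ ↦
    MetricFlow.integrable_of_bounded_measurable hfm fun x ↦
      abs_le.2 ⟨by linarith [hf0 x, hfM x], hfM x⟩
  have hfiη : Integrable (fun x ↦ f x + η) ν := (hfi ν).add (integrable_const η)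
  -- layer cake for `f, μ` and for `f + η, ν`
  have h1 : ∫ x, f x ∂μ = ∫ t in Ioc 0 M, μ.real {a | t ≤ f a} :=
    (hfi μ).integral_eq_integral_Ioc_meas_le (Eventually.of_forall hf0)
      (Eventually.of_forall hfM)
  have h2 : ∫ x, (f x + η) ∂ν = ∫ t in Ioc 0 (M + η), ν.real {a | t ≤ f a + η} :=
    hfiη.integral_eq_integral_Ioc_meas_le
      (Eventually.of_forall fun x ↦ show (0 : ℝ) ≤ f x + η by linarith [hf0 x])
      (Eventually.of_forall fun x ↦ show f x + η ≤ M + η by linarith [hfM x])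
  -- the pointwise bound given by the Lévy–Prokhorov distance
  have h3 : ∀ t, μ.real {a | t ≤ f a} ≤ ν.real {a | t ≤ f a + η} + η := fun t ↦ by
    have hle := left_measure_le_of_levyProkhorovEDist_lt h
      (measurableSet_le (measurable_const (a := t)) hfm)
    rw [ENNReal.toReal_ofReal hη.le] at hle
    have hsub : Metric.thickening η {a | t ≤ f a} ⊆ {a | t ≤ f a + η} := by
      intro x hx
      obtain ⟨y, hy, hxy⟩ := Metric.mem_thickening_iff.1 hx
      have hlip := hf.dist_le_mul y x
      rw [NNReal.coe_one, one_mul, Real.dist_eq, dist_comm] at hlip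
      have hy' : t ≤ f y := hy
      show t ≤ f x + η
      linarith [(abs_le.1 hlip).2]
    have hle' := ENNReal.toReal_mono (by finiteness) hle
    rw [ENNReal.toReal_add (measure_ne_top _ _) ENNReal.ofReal_ne_top, ENNReal.toReal_ofReal hη.le,
      ← measureReal_def, ← measureReal_def] at hle'
    linarith [measureReal_mono (μ := ν) hsub]
  -- integrate over `(0, M]`
  have hI5 : IntegrableOn (fun t ↦ ν.real {a | t ≤ f a + η}) (Ioc 0 (M + η)) :=
    integrableOn_measureReal_le ν (g := fun a ↦ f a + η) 0 (M + η)
  have hI5' : IntegrableOn (fun t ↦ ν.real {a | t ≤ f a + η}) (Ioc 0 M) :=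
    hI5.mono_set (Ioc_subset_Ioc_right (by linarith))
  calc ∫ x, f x ∂μ = ∫ t in Ioc 0 M, μ.real {a | t ≤ f a} := h1
    _ ≤ ∫ t in Ioc 0 M, (ν.real {a | t ≤ f a + η} + η) :=
        integral_mono (integrableOn_measureReal_le μ 0 M) (hI5'.add (integrable_const η)) h3
    _ = (∫ t in Ioc 0 M, ν.real {a | t ≤ f a + η}) + M * η := by
        rw [integral_add hI5' (integrable_const η), setIntegral_const, smul_eq_mul,
          Real.volume_real_Ioc_of_le hM, sub_zero]
    _ ≤ (∫ t in Ioc 0 (M + η), ν.real {a | t ≤ f a + η}) + M * η := by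
        have hst : Ioc (0 : ℝ) M ⊆ Ioc 0 (M + η) := Ioc_subset_Ioc_right (by linarith)
        have hmono := setIntegral_mono_set hI5
          (Eventually.of_forall fun t ↦ (measureReal_nonneg : 0 ≤ ν.real {a | t ≤ f a + η}))
          hst.eventuallyLE
        linarith
    _ = ∫ x, (f x + η) ∂ν + M * η := by rw [h2]
    _ = ∫ x, f x ∂ν + (M + 1) * η := by
        rw [integral_add (hfi ν) (integrable_const η), integral_const, smul_eq_mul,
          probReal_univ]
        ring

end LevyProkhorov

/-! ### Second moments: integrability, tails of truncations, lower semicontinuity -/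

section Moments

variable {Z : Type*} [MetricSpace Z] [MeasurableSpace Z] [BorelSpace Z]

omit [MeasurableSpace Z] [BorelSpace Z] in
/-- `d(z₀, z)²` read in `ℝ≥0∞`. [folklore] -/
private theorem ofReal_dist_sq (z₀ z : Z) : ENNReal.ofReal (dist z₀ z ^ 2) = edist z₀ z ^ 2 := by
  rw [edist_dist, ENNReal.ofReal_pow dist_nonneg]

/-- A bound `∫ d(z₀, ·)² dμ ≤ V` in `ℝ≥0∞` makes `d(z₀, ·)²` integrable. [folklore] -/
theorem integrable_dist_sq_of_lintegral_le {μ : Measure Z} {z₀ : Z} {V : ℝ}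
    (hV : ∫⁻ z, edist z₀ z ^ 2 ∂μ ≤ ENNReal.ofReal V) :
    Integrable (fun z ↦ dist z₀ z ^ 2) μ := by
  refine ⟨by fun_prop, ?_⟩
  rw [hasFiniteIntegral_iff_ofReal (Eventually.of_forall fun z ↦ by positivity)]
  simp only [ofReal_dist_sq]
  exact hV.trans_lt ENNReal.ofReal_lt_top

omit [BorelSpace Z] in
/-- A probability measure with finite second moment has finite first moment
(`d ≤ 1 + d²`). [folklore] -/
theorem lintegral_edist_ne_top_of_sq {μ : Measure Z} [IsProbabilityMeasure μ] {z₀ : Z} {V : ℝ}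
    (hV : ∫⁻ z, edist z₀ z ^ 2 ∂μ ≤ ENNReal.ofReal V) : ∫⁻ z, edist z₀ z ∂μ ≠ ∞ := by
  have hpt : ∀ z, edist z₀ z ≤ 1 + edist z₀ z ^ 2 := fun z ↦ by
    rcases le_total (edist z₀ z) 1 with h | h
    · exact h.trans le_self_add
    · exact (le_self_pow h two_ne_zero).trans le_add_self
  refine ne_top_of_le_ne_top ?_ (lintegral_mono hpt)
  rw [lintegral_add_left measurable_const, lintegral_const, measure_univ, mul_one]
  exact ENNReal.add_ne_top.2 ⟨ENNReal.one_ne_top, ne_top_of_le_ne_top ENNReal.ofReal_ne_top hV⟩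

/-- The truncation `a ↦ max(min(a, R), −R)` moves `a` by at most `d²/R` if `|a| ≤ d`. [folklore] -/
private theorem abs_sub_trunc_le {a d R : ℝ} (hR : 0 < R) (had : |a| ≤ d) :
    |a - max (min a R) (-R)| ≤ d ^ 2 / R := by
  rw [le_div_iff₀ hR]
  have hd : 0 ≤ d := (abs_nonneg a).trans had
  obtain ⟨ha1, ha2⟩ := abs_le.1 had
  rcases le_total a R with h1 | h1
  · rw [min_eq_left h1]
    rcases le_total (-R) a with h2 | h2
    · rw [max_eq_left h2, sub_self, abs_zero, zero_mul]
      positivity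
    · rw [max_eq_right h2, sub_neg_eq_add, abs_of_nonpos (by linarith)]
      nlinarith [mul_nonneg (by linarith : 0 ≤ a + d) hR.le, sq_nonneg (d - R),
        mul_nonneg hd hR.le]
  · rw [min_eq_right h1, max_eq_left (by linarith : -R ≤ R), abs_of_nonneg (by linarith)]
    nlinarith [mul_nonneg (by linarith : 0 ≤ d - a) hR.le, sq_nonneg (d - R),
      mul_nonneg hd hR.le]

/-- **Tail estimate from the second moment**: for a `1`-Lipschitz `v` with `v(z₀) = 0` and its
truncation `v_R := max(min(v, R), −R)`, `|∫ v dμ − ∫ v_R dμ| ≤ Var(δ_{z₀}, μ)/R ≤ V/R`, since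
`|v − v_R| ≤ d(z₀, ·)²/R` pointwise. [folklore] -/
theorem abs_integral_sub_integral_trunc_le (μ : Measure Z) [IsProbabilityMeasure μ] (z₀ : Z)
    {V R : ℝ} (hV0 : 0 ≤ V) (hR : 0 < R) (hV : ∫⁻ z, edist z₀ z ^ 2 ∂μ ≤ ENNReal.ofReal V)
    {v : Z → ℝ} (hv : LipschitzWith 1 v) (hv0 : v z₀ = 0) :
    |∫ z, v z ∂μ - ∫ z, max (min (v z) R) (-R) ∂μ| ≤ V / R := by
  have hvm : Measurable v := hv.continuous.measurable
  have hvd : ∀ z, |v z| ≤ dist z₀ z := fun z ↦ by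
    have h := hv.dist_le_mul z z₀
    rwa [NNReal.coe_one, one_mul, hv0, Real.dist_eq, sub_zero, dist_comm] at h
  have hi2 : Integrable (fun z ↦ dist z₀ z ^ 2) μ := integrable_dist_sq_of_lintegral_le hV
  have hi21 : Integrable (fun z ↦ dist z₀ z ^ 2 + 1) μ := hi2.add (integrable_const 1)
  have hiv : Integrable v μ := by
    refine hi21.mono' hvm.aestronglyMeasurable (Eventually.of_forall fun z ↦ ?_)
    rw [Real.norm_eq_abs]
    nlinarith [hvd z, sq_nonneg (dist z₀ z - 1), abs_nonneg (v z)]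
  have hiw : Integrable (fun z ↦ max (min (v z) R) (-R)) μ :=
    MetricFlow.integrable_of_bounded_measurable ((hvm.min measurable_const).max measurable_const)
      (C := R) fun z ↦ abs_le.2 ⟨le_max_right _ _, max_le (min_le_right _ _) (by linarith)⟩
  rw [← integral_sub hiv hiw]
  calc |∫ z, (v z - max (min (v z) R) (-R)) ∂μ| ≤ ∫ z, |v z - max (min (v z) R) (-R)| ∂μ :=
        abs_integral_le_integral_abs
    _ ≤ ∫ z, dist z₀ z ^ 2 / R ∂μ :=
        integral_mono_of_nonneg (Eventually.of_forall fun z ↦ abs_nonneg _) (hi2.div_const R)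
          (Eventually.of_forall fun z ↦ abs_sub_trunc_le hR (hvd z))
    _ = (∫ z, dist z₀ z ^ 2 ∂μ) / R := integral_div R _
    _ ≤ V / R := by
        gcongr
        rw [integral_eq_lintegral_of_nonneg_ae (Eventually.of_forall fun z ↦ by positivity)
          (by fun_prop)]
        simp only [ofReal_dist_sq]
        exact ENNReal.toReal_le_of_le_ofReal hV0 hV

/-- **`Var(δ_{z₀}, α_∞) ≤ V` for a weak limit of measures with `Var(δ_{z₀}, α_n) ≤ V`** (the
second assertion of Bamler's Lemma, for pointed variances): the second moment is a weakly lower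
semicontinuous functional — portmanteau for the open superlevel sets and layer cake (Mathlib's
`lintegral_le_liminf_lintegral_of_forall_isOpen_measure_le_liminf_measure`).
[cite: Bamler2023, §2.2, Lemma (weak convergence and bounded variance; arXiv v1 Lemma 12)] -/
theorem lintegral_edist_sq_le_of_tendsto {α : ℕ → ProbabilityMeasure Z}
    {αinf : ProbabilityMeasure Z} (hα : Tendsto α atTop (𝓝 αinf)) (z₀ : Z) {V : ℝ}
    (hV : ∀ n, ∫⁻ z, edist z₀ z ^ 2 ∂(α n : Measure Z) ≤ ENNReal.ofReal V) :
    ∫⁻ z, edist z₀ z ^ 2 ∂(αinf : Measure Z) ≤ ENNReal.ofReal V := by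
  have h := lintegral_le_liminf_lintegral_of_forall_isOpen_measure_le_liminf_measure
    (μ := (αinf : Measure Z)) (μs := fun i ↦ (α i : Measure Z)) (f := fun z ↦ dist z₀ z ^ 2)
    (by fun_prop) (fun z ↦ by positivity)
    fun G hG ↦ ProbabilityMeasure.le_liminf_measure_open_of_tendsto hα hG
  simp only [ofReal_dist_sq] at h
  exact h.trans (liminf_le_of_frequently_le' (Frequently.of_forall hV))

end Moments

/-! ### Weak convergence with bounded second moments implies `W₁`-convergence -/

section Main

variable {Z : Type*} [MetricSpace Z] [MeasurableSpace Z] [BorelSpace Z]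

/-- **The core estimate**: if `Var(δ_{z₀}, μ), Var(δ_{z₀}, ν) ≤ V` and `d_{LP}(μ, ν) < η`, then
`∫ u dμ − ∫ u dν ≤ 2V/R + (2R + 1) η` for every bounded `1`-Lipschitz `u` and every `R > 0` —
normalise `u(z₀) = 0`, truncate at level `R` (`abs_integral_sub_integral_trunc_le`, twice `V/R`)
and compare the truncations through the Lévy–Prokhorov distance
(`integral_le_integral_add_of_levyProkhorovEDist_lt` for `u_R + R ∈ [0, 2R]`).
[cite: Villani2003, Thm. 7.12, proof] -/
theorem integral_sub_integral_le_of_levyProkhorovEDist_lt {μ ν : Measure Z}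
    [IsProbabilityMeasure μ] [IsProbabilityMeasure ν] (z₀ : Z) {V R η : ℝ} (hV0 : 0 ≤ V)
    (hR : 0 < R) (hη : 0 < η) (hμ : ∫⁻ z, edist z₀ z ^ 2 ∂μ ≤ ENNReal.ofReal V)
    (hν : ∫⁻ z, edist z₀ z ^ 2 ∂ν ≤ ENNReal.ofReal V)
    (hLP : levyProkhorovEDist μ ν < ENNReal.ofReal η) {u : Z → ℝ} (hu : LipschitzWith 1 u)
    (hub : ∃ C, ∀ x, |u x| ≤ C) :
    ∫ z, u z ∂μ - ∫ z, u z ∂ν ≤ 2 * V / R + (2 * R + 1) * η := by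
  obtain ⟨C, hC⟩ := hub
  have hui : ∀ (ρ : Measure Z) [IsFiniteMeasure ρ], Integrable u ρ := fun ρ _ ↦
    MetricFlow.integrable_of_bounded_measurable hu.continuous.measurable hC
  -- normalisation `v := u − u(z₀)` and truncation `w := max(min(v, R), −R)`
  set v : Z → ℝ := fun z ↦ u z + -u z₀ with hvdef
  have hv : LipschitzWith 1 v := LipschitzWith.of_dist_le_mul fun x y ↦ by
    rw [show dist (v x) (v y) = dist (u x) (u y) from dist_add_right _ _ _]
    exact hu.dist_le_mul x y
  have hvint : ∀ (ρ : Measure Z) [IsProbabilityMeasure ρ], ∫ z, v z ∂ρ = ∫ z, u z ∂ρ + -u z₀ :=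
    fun ρ _ ↦ by
      simp only [hvdef]
      rw [integral_add (hui ρ) (integrable_const _), integral_const, smul_eq_mul, probReal_univ,
        one_mul]
  set w : Z → ℝ := fun z ↦ max (min (v z) R) (-R) with hwdef
  have hw : LipschitzWith 1 w := (hv.min_const R).max_const (-R)
  have hwb : ∀ z, |w z| ≤ R := fun z ↦
    abs_le.2 ⟨le_max_right _ _, max_le (min_le_right _ _) (by linarith)⟩
  have hwi : ∀ (ρ : Measure Z) [IsFiniteMeasure ρ], Integrable w ρ := fun ρ _ ↦
    MetricFlow.integrable_of_bounded_measurable hw.continuous.measurable hwb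
  -- tails
  have h1 : |∫ z, v z ∂μ - ∫ z, w z ∂μ| ≤ V / R :=
    abs_integral_sub_integral_trunc_le μ z₀ hV0 hR hμ hv (add_neg_cancel (u z₀))
  have h2 : |∫ z, v z ∂ν - ∫ z, w z ∂ν| ≤ V / R :=
    abs_integral_sub_integral_trunc_le ν z₀ hV0 hR hν hv (add_neg_cancel (u z₀))
  -- the truncations, through the Lévy–Prokhorov distance (`w + R ∈ [0, 2R]`)
  have hwR : LipschitzWith 1 fun z ↦ w z + R := LipschitzWith.of_dist_le_mul fun x y ↦ by
    rw [dist_add_right]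
    exact hw.dist_le_mul x y
  have h3 : ∫ z, (w z + R) ∂μ ≤ ∫ z, (w z + R) ∂ν + (2 * R + 1) * η :=
    integral_le_integral_add_of_levyProkhorovEDist_lt hη (by positivity) hLP hwR
      (fun z ↦ by linarith [(abs_le.1 (hwb z)).1]) (fun z ↦ by linarith [(abs_le.1 (hwb z)).2])
  rw [integral_add (hwi μ) (integrable_const R), integral_add (hwi ν) (integrable_const R)] at h3
  simp only [integral_const, smul_eq_mul, probReal_univ, one_mul] at h3
  -- assembly
  have e : ∫ z, u z ∂μ - ∫ z, u z ∂ν = ∫ z, v z ∂μ - ∫ z, v z ∂ν := by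
    rw [hvint μ, hvint ν]; ring
  rw [e, show 2 * V / R = V / R + V / R by ring]
  linarith [(abs_le.1 h1).2, (abs_le.1 h2).1]

variable [SecondCountableTopology Z]

/-- Weak convergence is convergence for the Lévy–Prokhorov metric on a separable space (Mathlib's
`LevyProkhorov.continuous_ofMeasure_probabilityMeasure`): eventually `d_{LP}(α_n, α_∞) < η`.
[folklore] -/
theorem eventually_levyProkhorovEDist_lt_of_tendsto {α : ℕ → ProbabilityMeasure Z}
    {αinf : ProbabilityMeasure Z} (hα : Tendsto α atTop (𝓝 αinf)) {η : ℝ} (hη : 0 < η) :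
    ∀ᶠ n in atTop,
      levyProkhorovEDist (α n : Measure Z) (αinf : Measure Z) < ENNReal.ofReal η := by
  have h := (LevyProkhorov.continuous_ofMeasure_probabilityMeasure.tendsto αinf).comp hα
  filter_upwards [EMetric.tendsto_nhds.1 h _ (ENNReal.ofReal_pos.2 hη)] with n hn
  rwa [Function.comp_apply, LevyProkhorov.edist_probabilityMeasure_def] at hn

variable [CompleteSpace Z]

/-- **Weak convergence with uniformly bounded second moments implies `W₁`-convergence** (Bamler
2023, §2.2, Lemma (arXiv v1 Lemma 12): *"a sequence `μ_i ∈ 𝒫(X)` that weakly converges to some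
`μ_∞ ∈ 𝒫(X)` and satisfies `Var(μ_i) ≤ C < ∞` … Then `μ_i → μ_∞` in `d_{W₁}`"*; Villani 2003,
Thm. 7.12): on a complete separable metric space, if `α_n → α_∞` weakly and
`∫ d(z₀, ·)² dα_n ≤ V` for all `n`, then `d_{W₁}(α_n, α_∞) → 0` — the limit has the same moment
bound (`lintegral_edist_sq_le_of_tendsto`), so `wassersteinW1_le_of_forall_integral_sub_le` applies,
and `integral_sub_integral_le_of_levyProkhorovEDist_lt` with `R = 4V/δ + 1`, `(2R + 1) η = δ/2`,
`d_{LP}(α_n, α_∞) < η` eventually gives `d_{W₁}(α_n, α_∞) ≤ δ` eventually.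
[cite: Bamler2023, §2.2, Lemma (weak convergence and bounded variance; arXiv v1 Lemma 12)]
[cite: Villani2003, Thm. 7.12] -/
theorem tendsto_wassersteinW1_of_tendsto_of_variance_le
    {α : ℕ → ProbabilityMeasure Z} {αinf : ProbabilityMeasure Z}
    (hα : Tendsto α atTop (𝓝 αinf)) (z₀ : Z) {V : ℝ}
    (hV : ∀ n, ∫⁻ z, edist z₀ z ^ 2 ∂(α n : Measure Z) ≤ ENNReal.ofReal V) :
    Tendsto (fun n ↦ wassersteinW1 (α n : Measure Z) (αinf : Measure Z)) atTop (𝓝 0) := by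
  -- without loss of generality `0 ≤ V`
  set V' : ℝ := max V 0 with hV'def
  have hV'0 : 0 ≤ V' := le_max_right _ _
  have hV' : ∀ n, ∫⁻ z, edist z₀ z ^ 2 ∂(α n : Measure Z) ≤ ENNReal.ofReal V' := fun n ↦
    (hV n).trans (ENNReal.ofReal_le_ofReal (le_max_left _ _))
  have hVinf : ∫⁻ z, edist z₀ z ^ 2 ∂(αinf : Measure Z) ≤ ENNReal.ofReal V' :=
    lintegral_edist_sq_le_of_tendsto hα z₀ hV'
  rw [ENNReal.tendsto_atTop_zero]
  intro ε hε
  -- a real `δ > 0` below `ε`, then the truncation level `R` and the Lévy–Prokhorov radius `η`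
  obtain ⟨δ, hδ0, hδε⟩ : ∃ δ : ℝ, 0 < δ ∧ ENNReal.ofReal δ ≤ ε := by
    rcases eq_or_ne ε ∞ with h | h
    · exact ⟨1, one_pos, h ▸ le_top⟩
    · exact ⟨ε.toReal, ENNReal.toReal_pos hε.ne' h, (ENNReal.ofReal_toReal h).le⟩
  set R : ℝ := 4 * V' / δ + 1 with hRdef
  have hR0 : 0 < R := by positivity
  have hR : 2 * V' / R ≤ δ / 2 := by
    rw [div_le_div_iff₀ hR0 two_pos]
    have : δ * R = 4 * V' + δ := by
      rw [hRdef, mul_add, mul_one, mul_div_cancel₀ _ hδ0.ne']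
    nlinarith
  set η : ℝ := δ / (2 * (2 * R + 1)) with hηdef
  have hη0 : 0 < η := by positivity
  have hη : (2 * R + 1) * η = δ / 2 := by rw [hηdef]; field_simp
  obtain ⟨N, hN⟩ := eventually_atTop.1 (eventually_levyProkhorovEDist_lt_of_tendsto hα hη0)
  refine ⟨N, fun n hn ↦ hδε.trans' ?_⟩
  refine wassersteinW1_le_of_forall_integral_sub_le _ _ z₀ (lintegral_edist_ne_top_of_sq (hV' n))
    (lintegral_edist_ne_top_of_sq hVinf) fun u hu hub ↦ ENNReal.ofReal_le_ofReal ?_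
  have h := integral_sub_integral_le_of_levyProkhorovEDist_lt z₀ hV'0 hR0 hη0 (hV' n) hVinf
    (hN n hn) hu hub
  linarith

/-- **Tight sequences with bounded second moments subconverge in `W₁`** (Bamler 2023, §7.3, proof
of the Claim (arXiv v1 Claim 162): *"Due to Lemmas 2.4 (d), [§2.2] it suffices to show that the
sequence of probability measures … is tight"*): on a complete separable metric space, a tight
sequence of probability measures `α_n` with `∫ d(z₀, ·)² dα_n ≤ V` has a subsequence
`W₁`-converging to a probability measure `α_∞` with `∫ d(z₀, ·)² dα_∞ ≤ V` — Prokhorov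
(`isCompact_closure_of_isTightMeasureSet`), `lintegral_edist_sq_le_of_tendsto` and
`tendsto_wassersteinW1_of_tendsto_of_variance_le` along the subsequence.
[cite: Bamler2023, §7.3, proof of the Claim (arXiv v1 Claim 162), via Lemma 2.4 (d)] -/
theorem exists_subseq_tendsto_wassersteinW1_of_isTightMeasureSet
    {α : ℕ → Measure Z} [∀ n, IsProbabilityMeasure (α n)]
    (htight : IsTightMeasureSet (Set.range α))
    (z₀ : Z) {V : ℝ} (hV : ∀ n, ∫⁻ z, edist z₀ z ^ 2 ∂α n ≤ ENNReal.ofReal V) :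
    ∃ φ : ℕ → ℕ, StrictMono φ ∧ ∃ αinf : Measure Z, IsProbabilityMeasure αinf ∧
      ∫⁻ z, edist z₀ z ^ 2 ∂αinf ≤ ENNReal.ofReal V ∧
      Tendsto (fun n ↦ wassersteinW1 (α (φ n)) αinf) atTop (𝓝 0) := by
  set P : ℕ → ProbabilityMeasure Z := fun n ↦ ⟨α n, inferInstance⟩ with hP
  have hcomp : IsCompact (closure (range P)) := by
    refine isCompact_closure_of_isTightMeasureSet (htight.subset ?_)
    rintro _ ⟨_, ⟨k, rfl⟩, rfl⟩
    exact ⟨k, rfl⟩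
  obtain ⟨Plim, -, φ, hφ, hlim⟩ :=
    hcomp.tendsto_subseq (x := P) fun k ↦ subset_closure (mem_range_self k)
  have hVφ : ∀ n, ∫⁻ z, edist z₀ z ^ 2 ∂((P ∘ φ) n : Measure Z) ≤ ENNReal.ofReal V :=
    fun n ↦ hV (φ n)
  exact ⟨φ, hφ, Plim, inferInstance, lintegral_edist_sq_le_of_tendsto hlim z₀ hVφ,
    tendsto_wassersteinW1_of_tendsto_of_variance_le hlim z₀ hVφ⟩

end Main

end Literature.Geometry.Riemannian

end
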